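/-
Copyright: lit-balaban Phase-2 proof seat p33 (gen 8).  Statement-level skeleton of a published paper; no proof claims beyond what
the kernel checks below.
-/
import Literature.MathematicalPhysics.QuantumFieldTheory.BalabanImbrieJaffe1984to88.BIJ85ScalarPropagatorDecay
import Literature.MathematicalPhysics.QuantumFieldTheory.BalabanImbrieJaffe1984to88.BIJ85Claim73Closed

/-!
# [BalabanImbrieJaffe1985] §7.3, p. 326: «The propagators arising from Δ_k(u_k), under the restriction (7.3.1) on the gauge field, also
# satisfy the … decay estimates of [7]» — THE DECAY MEMBER, PROVED on the torus for the actual background (4.5.4) (kernel file 3 of 3)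

T. Bałaban, J. Imbrie, A. Jaffe, *Renormalization of the Higgs model: minimizers, propagators and the stability of mean field theory*,
Commun. Math. Phys. **97** (1985) 299–329 [BalabanImbrieJaffe1985].  Row **C1.Eq7.3.1-7.3.2** of the lit-balaban skeleton (owner r15):
the last open prose sentence of Sect. 7.3 (the cell's ROWS-C1 «NOT COVERED … the regularity/decay sentence on the Δ_k(u_k)-propagators»),
its DECAY half.

statement-level skeleton of published theorems with citation tags; proofs where landed; nothing here is a claim about the Yang–Mills mass gap

PDF held: `paper:balaban1985-cmp97-bij-higgs-minimizers` (p. 326 = PDF 28; p. 313 = PDF 15); text layer re-read this session.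

THE PRINTED TEXT, verbatim, p. 326 [PDF 28]: *"In particular, let us assume that for the unit lattice field v, |v(∂p) − 1| ≤ e_k𝓅(e_k), (7.3.1)
… The propagators arising from Δ_k(u_k), under the restriction (7.3.1) on the gauge field, also satisfy the regularity and decay estimates
of [7]. In order to remain within the framework of this reference, we remark that by change of gauge u_k can be transformed in a local
region Λ into a configuration of the form exp[ie_kηA], where A is smooth and small."*  [7] = [Balaban1983RegularityDecay] (B4), Cor. 2.3
(2.30) p. 580: `|⟨f, G_k(Ω,A)f′⟩| ≤ c₀e^{−δ₀dist(supp f, supp f′)}‖f‖₂‖f′‖₂` *"for e sufficiently small"*.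

WHAT IS PROVED (theorems only; no `def`, no new named fact).
* **`kappa_phys_le`** (real arithmetic): at the rate `t₀ = √(m′/(12d + 3a))`, `m′ = min(a/2, 1/4)`, the conjugation defect is at most half
  the coercivity constant: `(2d·e^{t₀/n} + (a/2)e^{t₀})t₀² ≤ m′/2`.
* **`decay_pairing_phys`** — EVERY `U(1)` BACKGROUND with the block-scale plaquette smallness `2d³(L^{2k}·max‖u(∂p) − 1‖)² ≤ 1`, physical
  normalization `c = cPhys` (`c² = η^{d−2} = n²/N`, p11), every `a > 0`, any right inverse `G` of `D_u^*D_u + aQ_k(u)^*Q_k(u)` (4.6.2): for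
  `h` supported in `X` and `h′` supported at `ℓ^∞`-distance `≥ D` (η-steps) from `X`,
  `|⟨h′, Gh⟩| ≤ (2N/min(a/2, 1/4))·exp(−t₀·D/L^k)·‖h′‖‖h‖` — exponential decay in the unit-lattice distance `D/L^k` at the rate `t₀(d, a)`,
  UNIFORM in `k`, in the volume and in the background (`BIJ85ScalarPropagatorDecay.decay_pairing_dist` at `t = t₀`).  Normalization: at
  `c = cPhys` one has `⟨φ, Tφ⟩_{ℓ²} = ‖D_uφ‖²_η + a‖Q_k(u)φ‖² = ⟨φ, Δ_k(u)φ⟩_η` (p11, `BIJ85Ineq732Flat.cPhys`), so at base level `0` the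
  right inverse `G` of `T` in the unweighted `ℓ²` is `η^{−d}·Δ_k(u)⁻¹ = N·G_k(u)`: for the paper's `G_k(u)` the prefactor is `2/m′` (in either
  normalization of the pairing).
* **`decay_pairing_closedG`** — THE SENTENCE FOR THE ACTUAL BACKGROUND (4.5.4): for every index `i : ClosedIdx d K_R 𝓅` of gen-7's
  `BIJ85Claim73Closed` (any torus of dimension `d ≥ 2`, `1 ≤ k ≤ m + K`, `0 < e_k ≤ 1` with `e_k𝓅(e_k) ≤ ½`, ANY unit field `v`, located
  residual input on closed fields — total at one `K_R` over all tori given [6I] Prop. 1.2, `BIJ85Claim73AllTori`) satisfying the printed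
  (7.3.1), in the small-coupling regime `2d³((π/2)K_R·e_k𝓅(e_k))² ≤ 1` (*"for e sufficiently small"*): THE propagator `G_k(u_k)` of (4.6.2) at
  the actual `u_k` (`closedG`, a_k = the printed `a_k`) satisfies `|⟨h′, G_k(u_k)h⟩| ≤ (2N/min(a_k/2, 1/4))·exp(−t₀(d, a_k)·D/L^k)·‖h′‖‖h‖`
  — the plaquette smallness being gen-7's `theta_of_hyp731_closed` ((7.3.1) ⇒ ‖u_k(∂p) − 1‖ ≤ e_kη²K_R(π/2)𝓅(e_k)).
* **`decay_kernel_phys`** / **`decay_kernel_closedG`** — THE KERNEL, POINTWISE: `|G(x, y)| ≤ (2N/min(a/2, 1/4))·exp(−t₀·|x − y|_∞/L^k)`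
  for the matrix elements `G(x, y) = (Gδ_y)(x)` in the site basis of the η-lattice (`δ_y = PiLp.single 2 y 1`; at base level `0` these ARE
  the kernel `G_k(u; x, y)` of the paper w.r.t. `η^dΣ_y`, by the normalization remark above), for every background as above resp. for THE
  propagator `G_k(u_k)` of every closed-field index under (7.3.1) — the exponential DECAY of the printed *"|G_k(x, y)| ≤ O(1)…e^{−δ|x−y|}"* of
  [6I] (1.110) / [7] for the torus operator of record, with the crude diagonal constant `2N/m′ = 2η^{−d}/m′` in place of the printed
  `|x − y|^{2−d}`-type singularity (p. 326 *"singularities on the diagonal"*) (the pairing theorems at `h = δ_y`, `h′ = δ_x·G(x, y)`, `X = {y}`,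
  `D = |x − y|_∞`).
* **`agmon_weighted_energy`** / **`decay_energy_phys`** / **`decay_energy_closedG`** — THE COVARIANT GRADIENT, WEIGHTED ENERGY FORM:
  `‖D_u(e^{ρ}Gh)‖² + a‖Q_k(u)(e^{ρ}Gh)‖² ≤ (m₀/(m₀ − κ)²)‖e^{ρ}h‖²` for the abstract weight, and `≤ (4N/min(a/2, 1/4))·‖h‖²` at
  `ρ = t₀·dist_∞(·, supp h)/L^k` in the physical normalization resp. for THE propagator of every closed-field index under (7.3.1): the
  `c`-scaled covariant η-gradient and the block averages of `Gh` decay like `e^{−t₀·dist/L^k}` in `ℓ²` — the `∇G_k` member of [7]'s decay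
  estimates in energy form.
* §12 (v1.1) **`decay_gradKernel_phys`** / **`decay_gradKernel_closedG`** — THE COVARIANT GRADIENT OF THE KERNEL, POINTWISE:
  `|u_b·G(b₊, y) − G(b₋, y)| ≤ (2N/n)(1/√m′ + 3t₀/m′)·e^{−t₀|b₋ − y|_∞/L^k}` for every η-bond `b` and site `y` (so the η-lattice covariant
  gradient `η⁻¹(u_bG(b₊,y) − G(b₋,y))` of the kernel is `≤ 2N(1/√m′ + 3t₀/m′)e^{−t₀·dist/L^k}` at base level `0`): one coordinate of the
  weighted energy of §11 at `h = δ_y`, the product rule for `D_u(ωφ)`, and §10 for the commutator term — the `m = 1` member of the printed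
  *"|∇G_k(x, y)| ≤ O(1)…e^{−δ|x−y|}"*, exponential-decay part with a crude diagonal constant.
HONEST SCOPE.  (i) DECAY members only (pairing, pointwise kernel, covariant gradient in weighted-`ℓ²` form and pointwise): no Hölder-quotient / sharp-diagonal
REGULARITY member of [7]'s estimates, and not [7]'s route (local gauge change + random walk) — an energy (Agmon–Combes–Thomas) proof of the
same shape of statement, disclosed as a DIVERGENCE OF METHOD; (ii) pairings, norms and matrix elements are those of the unweighted `ℓ²`
of p11's carriers (site basis of `T_η`, base level `j`), in which `G = N·G_k(u)` (`N = L^{kd} = η^{−d}` at `j = 0`); the diagonal constant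
`2N/m′` of the kernel bound is crude (no `|x − y|^{2−d}` singularity resolved) and nothing is optimised; (iii) the smallness `2d³((π/2)K_R e_k𝓅(e_k))² ≤ 1` is an explicit "e_k sufficiently
small" condition depending on `(d, K_R, 𝓅)`; (iv) constants ours, not optimised; torus, `U(1)`, standing range.  Nothing here is summit
progress.
Unit `lit-balaban-p33` (literature-prover-lit-balaban-p33-g8-0), HOME `run/shared/lean/pub/lit-balaban/`, 2026-08-21.
-/

open scoped RealInnerProductSpace BigOperators ComplexConjugate
open Finset

namespace Literature.MathematicalPhysics.QuantumFieldTheory.BalabanImbrieJaffe1984to88.BIJ85Claim73PropagatorDecay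

open Literature.MathematicalPhysics.QuantumFieldTheory.Balaban1983to89
open BIJ88Sect3Statements (U1 toC norm_toC cfg covD)
open BIJ85BlockAveragesTorusK BIJ85ScalarPropagatorTorus BIJ85ScalarPropagatorTorusK
open BIJ85ScalarForm464 BIJ85Ineq732Flat BIJ85Ineq732General
open BIJ85AbelianStokes (plaqC)
open BIJ85AgmonDefect BIJ85ScalarPropagatorDecay
open BIJ85Claim73Closed BIJ85Sect7Statements
open BIJ85Eq454PlaqResidual (pow_mul_eta_sq)
open LatticeFieldCalculus (supDist)
open B3TorusRadialSums (supDist_comm)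

noncomputable section

variable {P : Params} {j : ℕ}

/-! ## §8 The physical normalization `c² = n²/N`: the rate `t₀(d, a)` and the constant `2N/min(a/2, 1/4)` -/

/-- kernel (real arithmetic): the conjugation defect at the rate `t₀ = √(m′/(12d + 3a))`, `m′ = min(a/2, 1/4)`, is at most half the
coercivity constant: `(2d·e^{t₀/n} + (a/2)e^{t₀})·t₀² ≤ m′/2` (`n ≥ 1`; `e < 3` and `(6d + 3a/2)/(12d + 3a) = ½`). [cite: BalabanImbrieJaffe1985, (7.3.2) p.326] -/
theorem kappa_phys_le {d a n : ℝ} (hd : 1 ≤ d) (ha : 0 < a) (hn : 1 ≤ n) :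
    (2 * d * Real.exp (Real.sqrt (min (a / 2) (1 / 4) / (12 * d + 3 * a)) / n)
        + a / 2 * Real.exp (Real.sqrt (min (a / 2) (1 / 4) / (12 * d + 3 * a))))
      * Real.sqrt (min (a / 2) (1 / 4) / (12 * d + 3 * a)) ^ 2 ≤ min (a / 2) (1 / 4) / 2 := by
  set m' := min (a / 2) (1 / 4) with hm'
  set t₀ := Real.sqrt (m' / (12 * d + 3 * a)) with ht₀
  have hm'0 : 0 < m' := lt_min (by linarith) (by norm_num)
  have hm'1 : m' ≤ 1 / 4 := min_le_right _ _
  have hden : 0 < 12 * d + 3 * a := by linarith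
  have ht₀sq : t₀ ^ 2 = m' / (12 * d + 3 * a) := Real.sq_sqrt (div_nonneg hm'0.le hden.le)
  have ht₀0 : 0 ≤ t₀ := Real.sqrt_nonneg _
  have ht₀1 : t₀ ≤ 1 := by
    rw [ht₀]
    refine Real.sqrt_le_one.mpr ?_ |>.trans le_rfl
    rw [div_le_one hden]; linarith
  have he3 : Real.exp 1 ≤ 3 := by have := Real.exp_one_lt_d9; linarith
  have he1 : Real.exp (t₀ / n) ≤ 3 :=
    (Real.exp_le_exp.2 ((div_le_self ht₀0 hn).trans ht₀1)).trans he3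
  have he2 : Real.exp t₀ ≤ 3 := (Real.exp_le_exp.2 ht₀1).trans he3
  have hd0 : 0 ≤ d := by linarith
  calc (2 * d * Real.exp (t₀ / n) + a / 2 * Real.exp t₀) * t₀ ^ 2
      ≤ (2 * d * 3 + a / 2 * 3) * t₀ ^ 2 := by
        refine mul_le_mul_of_nonneg_right ?_ (sq_nonneg _)
        nlinarith
    _ = m' / 2 := by rw [ht₀sq]; field_simp; ring

/-- kernel (physical normalization `c² = n²/N`, p11 `cPhys_sq`): the coercivity constant of `coercive_opT` is `m′/N`,
`m′ = min(a/2, 1/4)`, and at the rate `t₀ = √(m′/(12d + 3a))` the conjugation defect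
`κ(t₀) = 2d·c²(t₀/n)²e^{t₀/n} + a·t₀²e^{t₀}/(2N)` is at most `m′/(2N)` — half the coercivity constant. [cite: BalabanImbrieJaffe1985, (7.3.2) p.326] -/
private theorem phys_constants (k : ℕ) {a : ℝ} (ha : 0 < a) :
    min (a / 2) (cPhys P k ^ 2 * (P.L : ℝ) ^ (k * P.d) / (4 * ((P.L : ℝ) ^ k) ^ 2)) = min (a / 2) (1 / 4) ∧
    2 * P.d * cPhys P k ^ 2 * ((Real.sqrt (min (a / 2) (1 / 4) / (12 * P.d + 3 * a)) / (P.L : ℝ) ^ k) ^ 2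
          * Real.exp (Real.sqrt (min (a / 2) (1 / 4) / (12 * P.d + 3 * a)) / (P.L : ℝ) ^ k))
        + a * (Real.sqrt (min (a / 2) (1 / 4) / (12 * P.d + 3 * a)) ^ 2
          * Real.exp (Real.sqrt (min (a / 2) (1 / 4) / (12 * P.d + 3 * a))) / 2 * ((P.L : ℝ) ^ (k * P.d))⁻¹)
      ≤ min (a / 2) (1 / 4) / (2 * (P.L : ℝ) ^ (k * P.d)) := by
  set m' := min (a / 2) (1 / 4) with hm'
  set t₀ := Real.sqrt (m' / (12 * P.d + 3 * a)) with ht₀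
  set n : ℝ := (P.L : ℝ) ^ k with hn
  set N : ℝ := (P.L : ℝ) ^ (k * P.d) with hN
  have hn1 : 1 ≤ n := one_le_pow₀ (by exact_mod_cast P.L_pos)
  have hn0 : 0 < n := pow_pos P.cast_L_pos _
  have hN0 : 0 < N := pow_pos P.cast_L_pos _
  have hd1 : (1 : ℝ) ≤ P.d := by exact_mod_cast P.hd
  have hc2 : cPhys P k ^ 2 = n ^ 2 / N := cPhys_sq P k
  refine ⟨by rw [hc2]; congr 1; field_simp, ?_⟩
  have hκ' := kappa_phys_le hd1 ha hn1
  have e : 2 * P.d * cPhys P k ^ 2 * ((t₀ / n) ^ 2 * Real.exp (t₀ / n)) + a * (t₀ ^ 2 * Real.exp t₀ / 2 * N⁻¹)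
      = ((2 * P.d * Real.exp (t₀ / n) + a / 2 * Real.exp t₀) * t₀ ^ 2) / N := by
    rw [hc2]; field_simp
  rw [e, div_le_div_iff₀ hN0 (by positivity)]
  calc (2 * ↑P.d * Real.exp (t₀ / n) + a / 2 * Real.exp t₀) * t₀ ^ 2 * (2 * N)
      = ((2 * ↑P.d * Real.exp (t₀ / n) + a / 2 * Real.exp t₀) * t₀ ^ 2) * 2 * N := by ring
    _ ≤ (m' / 2) * 2 * N := by gcongr
    _ = m' * N := by ring

/-- **EXPONENTIAL DECAY OF THE SCALAR PROPAGATOR `G_k(u) = [D_u^*D_u + a Q_k(u)^*Q_k(u)]⁻¹` ON THE TORUS, PHYSICAL NORMALIZATION**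
(`c = cPhys`, `c² = η^{d−2} = n²/N`): for EVERY `U(1)` background `u` whose η-plaquette variables satisfy the block-scale smallness
`2d³(L^{2k}·max‖u(∂p) − 1‖)² ≤ 1`, every `a > 0`, any right inverse `G` of `D_u^*D_u + aQ_k(u)^*Q_k(u)`, every source `h` supported in
a set `X` and every test field `h′` supported at `ℓ^∞`-distance `≥ D` (η-steps) from `X`:
`|⟨h′, G h⟩| ≤ (2N/min(a/2, 1/4))·exp(−t₀·D/L^k)·‖h′‖‖h‖`, `t₀ = √(min(a/2,1/4)/(12d + 3a))` — exponential decay in the unit-lattice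
distance `D/L^k` at a rate depending on `(d, a)` only: UNIFORM in `k`, in the volume and in the background — the shape of [7] Cor. 2.3 (2.30)
for the torus operator of record. [cite: BalabanImbrieJaffe1985, (7.3.2) p.326] -/
theorem decay_pairing_phys {k : ℕ} (hk : j + k ≤ P.m + P.K) {a : ℝ} (ha : 0 < a) (U : GaugeField P j U1) {θ : ℝ}
    (hθ : ∀ (x : Balaban1983to89.Site P j) (μ ν : Fin P.d), ‖plaqC U x μ ν - 1‖ ≤ θ)
    (hsmall : 2 * (P.d : ℝ) ^ 3 * (((P.L : ℝ) ^ k) ^ 2 * θ) ^ 2 ≤ 1)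
    {G : FineSp P j →ₗ[ℝ] FineSp P j} (hG : ∀ φ, opT (Dlin (cPhys P k) U) (QlinK U k) a (G φ) = φ)
    (X : Finset (Balaban1983to89.Site P j)) {h h' : FineSp P j} (hh : ∀ x, h x ≠ 0 → x ∈ X) {D : ℕ}
    (hh' : ∀ x, h' x ≠ 0 → D ≤ distTo X x) :
    |⟪h', G h⟫| ≤ 2 * (P.L : ℝ) ^ (k * P.d) / min (a / 2) (1 / 4)
      * Real.exp (-(Real.sqrt (min (a / 2) (1 / 4) / (12 * P.d + 3 * a)) * D / (P.L : ℝ) ^ k)) * ‖h'‖ * ‖h‖ := by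
  obtain ⟨hmin, hκ⟩ := phys_constants (P := P) k ha
  set m' := min (a / 2) (1 / 4) with hm'
  set t₀ := Real.sqrt (m' / (12 * P.d + 3 * a)) with ht₀
  set n : ℝ := (P.L : ℝ) ^ k with hn
  set N : ℝ := (P.L : ℝ) ^ (k * P.d) with hN
  have hN0 : 0 < N := pow_pos P.cast_L_pos _
  have hm'0 : 0 < m' := lt_min (by linarith) (by norm_num)
  have ht₀0 : 0 ≤ t₀ := Real.sqrt_nonneg _
  have hlt : 2 * P.d * cPhys P k ^ 2 * ((t₀ / n) ^ 2 * Real.exp (t₀ / n)) + a * (t₀ ^ 2 * Real.exp t₀ / 2 * N⁻¹)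
      < min (a / 2) (cPhys P k ^ 2 * N / (4 * n ^ 2)) / N := by
    rw [hmin]
    refine hκ.trans_lt ?_
    rw [div_lt_div_iff₀ (by positivity) hN0]
    nlinarith
  have hmain := decay_pairing_dist hk (cPhys P k) ha U hθ hsmall ht₀0 hlt hG X hh hh'
  refine hmain.trans ?_
  rw [hmin]
  have hden : m' / (2 * N) ≤ m' / N - (2 * P.d * cPhys P k ^ 2 * ((t₀ / n) ^ 2 * Real.exp (t₀ / n))
      + a * (t₀ ^ 2 * Real.exp t₀ / 2 * N⁻¹)) := by
    have : m' / N - m' / (2 * N) = m' / (2 * N) := by field_simp; ring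
    linarith
  have hnum : 0 ≤ Real.exp (-(t₀ * D / n)) * ‖h'‖ * ‖h‖ := by positivity
  calc Real.exp (-(t₀ * D / n)) * ‖h'‖ * ‖h‖ / (m' / N - (2 * P.d * cPhys P k ^ 2 * ((t₀ / n) ^ 2 * Real.exp (t₀ / n))
          + a * (t₀ ^ 2 * Real.exp t₀ / 2 * N⁻¹)))
      ≤ Real.exp (-(t₀ * D / n)) * ‖h'‖ * ‖h‖ / (m' / (2 * N)) := div_le_div_of_nonneg_left hnum (by positivity) hden
    _ = 2 * N / m' * Real.exp (-(t₀ * D / n)) * ‖h'‖ * ‖h‖ := by field_simp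


/-! ## §9 Sect. 7.3: the propagator of the ACTUAL background under (7.3.1) -/

/-- **p. 326, «The propagators arising from Δ_k(u_k), under the restriction (7.3.1) on the gauge field, also satisfy the … decay estimates
of [7]» — THE DECAY MEMBER, for the ACTUAL background (4.5.4) of every closed-field index**: for `i : ClosedIdx d K_R 𝓅` (any torus of
dimension `d ≥ 2`, `1 ≤ k ≤ m + K`, `0 < e_k ≤ 1` with `e_k𝓅(e_k) ≤ ½`, ANY unit field `v`) satisfying the printed (7.3.1), in the
small-coupling regime `2d³((π/2)K_R·e_k𝓅(e_k))² ≤ 1`, THE propagator `G_k(u_k) = [D_{u_k}^*D_{u_k} + a_kQ_k(u_k)^*Q_k(u_k)]⁻¹` of (4.6.2)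
(gen-7's `closedG`) obeys `|⟨h′, G_k(u_k)h⟩| ≤ (2N/min(a_k/2, 1/4))·exp(−t₀(d, a_k)·D/L^k)·‖h′‖‖h‖` for `h` supported in `X` and `h′` at
`ℓ^∞`-distance `≥ D` from `X` — uniformly in `k`, the volume and `v`. [cite: BalabanImbrieJaffe1985, (7.3.1)–(7.3.2) p.326] -/
theorem decay_pairing_closedG {d : ℕ} {KR pexp : ℝ} (a : ℝ) (ha : 0 < a) (i : ClosedIdx d KR pexp)
    (h731 : (closedStabData a ha i).Hyp731 pexp)
    (hsmallK : 2 * (d : ℝ) ^ 3 * (Real.pi / 2 * KR * (i.e * (1 + Real.log i.e⁻¹) ^ pexp)) ^ 2 ≤ 1)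
    (X : Finset (Balaban1983to89.Site i.P 0)) {h h' : FineSp i.P 0} (hh : ∀ x, h x ≠ 0 → x ∈ X) {D : ℕ}
    (hh' : ∀ x, h' x ≠ 0 → D ≤ distTo X x) :
    |⟪h', closedG a ha i h⟫| ≤ 2 * (i.P.L : ℝ) ^ (i.k * i.P.d) / min (BIJ85Sect4Statements.aK a i.P.L i.k / 2) (1 / 4)
      * Real.exp (-(Real.sqrt (min (BIJ85Sect4Statements.aK a i.P.L i.k / 2) (1 / 4)
          / (12 * i.P.d + 3 * BIJ85Sect4Statements.aK a i.P.L i.k)) * D / (i.P.L : ℝ) ^ i.k)) * ‖h'‖ * ‖h‖ := by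
  have hθ := theta_of_hyp731_closed a ha i h731
  have hsmall : 2 * (i.P.d : ℝ) ^ 3 *
      (((i.P.L : ℝ) ^ i.k) ^ 2 * (i.e * (i.P.eta i.k) ^ 2 * (KR * (Real.pi / 2 * (1 + Real.log i.e⁻¹) ^ pexp)))) ^ 2 ≤ 1 := by
    have e : ((i.P.L : ℝ) ^ i.k) ^ 2 * (i.e * (i.P.eta i.k) ^ 2 * (KR * (Real.pi / 2 * (1 + Real.log i.e⁻¹) ^ pexp)))
        = Real.pi / 2 * KR * (i.e * (1 + Real.log i.e⁻¹) ^ pexp) := by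
      have h1 := pow_mul_eta_sq i.P i.k
      calc ((i.P.L : ℝ) ^ i.k) ^ 2 * (i.e * (i.P.eta i.k) ^ 2 * (KR * (Real.pi / 2 * (1 + Real.log i.e⁻¹) ^ pexp)))
          = (((i.P.L : ℝ) ^ i.k) ^ 2 * (i.P.eta i.k) ^ 2) * (Real.pi / 2 * KR * (i.e * (1 + Real.log i.e⁻¹) ^ pexp)) := by ring
        _ = _ := by rw [h1, one_mul]
    rw [e, i.hd]; exact hsmallK
  exact decay_pairing_phys i.hk0 (i.aK_pos ha) i.U hθ hsmall (closedG_spec a ha i) X hh hh'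

/-! ## §10 The kernel: pointwise exponential decay of `G(x, y) = (Gδ_y)(x)` -/

/-- kernel: the real pairing of the one-site field `δ_x·z` with `φ` is `Re(z̄·φ(x))`. [cite: BalabanImbrieJaffe1985, (4.6.1) p.313] -/
private theorem inner_single_left (x : Balaban1983to89.Site P j) (z : ℂ) (φ : FineSp P j) :
    ⟪(PiLp.single 2 x z : FineSp P j), φ⟫ = (conj z * φ x).re := by
  rw [inner_eq_re_sum, Finset.sum_eq_single x]
  · rw [PiLp.single_apply, if_pos rfl]
  · intro w _ hw
    rw [PiLp.single_apply, if_neg hw, map_zero, zero_mul, Complex.zero_re]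
  · intro hx; exact (hx (Finset.mem_univ x)).elim

/-- kernel: a pairing bound `|⟨h′, Gh⟩| ≤ C‖h′‖‖h‖` for all `h` supported in `{y}` and all `h′` supported in `{x}` bounds the matrix element:
`|(Gδ_y)(x)| ≤ C` (test against `h′ = δ_x·(Gδ_y)(x)`). [cite: BalabanImbrieJaffe1985, (7.3.2) p.326] -/
private theorem kernel_of_pairing {G : FineSp P j →ₗ[ℝ] FineSp P j} {C : ℝ} (hC : 0 ≤ C) (x y : Balaban1983to89.Site P j)
    (hpair : ∀ h h' : FineSp P j, (∀ w, h w ≠ 0 → w ∈ ({y} : Finset (Balaban1983to89.Site P j))) → (∀ w, h' w ≠ 0 → w = x) →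
      |⟪h', G h⟫| ≤ C * ‖h'‖ * ‖h‖) :
    ‖G (PiLp.single 2 y (1 : ℂ)) x‖ ≤ C := by
  set z : ℂ := G (PiLp.single 2 y (1 : ℂ)) x with hz
  have hsupp : ∀ w, (PiLp.single 2 y (1 : ℂ) : FineSp P j) w ≠ 0 → w ∈ ({y} : Finset (Balaban1983to89.Site P j)) := by
    intro w hw
    rw [PiLp.single_apply] at hw
    by_cases hwy : w = y
    · rw [hwy]; exact Finset.mem_singleton_self y
    · exact (hw (if_neg hwy)).elim
  have hsupp' : ∀ w, (PiLp.single 2 x z : FineSp P j) w ≠ 0 → w = x := by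
    intro w hw
    rw [PiLp.single_apply] at hw
    by_contra hwx
    exact hw (if_neg hwx)
  have key := hpair _ _ hsupp hsupp'
  rw [inner_single_left, PiLp.norm_single, PiLp.norm_single, norm_one, mul_one, ← hz] at key
  have hre : (conj z * z).re = ‖z‖ ^ 2 := by rw [Complex.conj_mul']; norm_cast
  rw [hre, abs_of_nonneg (sq_nonneg _), sq] at key
  by_cases hz0 : ‖z‖ = 0
  · rw [hz0]; exact hC
  · exact le_of_mul_le_mul_right key (lt_of_le_of_ne (norm_nonneg _) (Ne.symm hz0))

/-- **POINTWISE EXPONENTIAL DECAY OF THE KERNEL OF `G_k(u) = [D_u^*D_u + aQ_k(u)^*Q_k(u)]⁻¹`, PHYSICAL NORMALIZATION**: for EVERY `U(1)`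
background with `2d³(L^{2k}·max‖u(∂p) − 1‖)² ≤ 1`, every `a > 0` and any right inverse `G`, the matrix elements in the site basis of the
η-lattice obey `|(Gδ_y)(x)| ≤ (2N/min(a/2, 1/4))·exp(−t₀·|x − y|_∞/L^k)`, `t₀ = √(min(a/2,1/4)/(12d + 3a))`, `|x − y|_∞` the torus distance in
η-steps (so `|x − y|_∞/L^k` is the unit-lattice distance) — the printed shape `|G_k(x, y)| ≤ O(1)e^{−δ|x−y|}` of [6I] (1.110) / [7] for the
torus operator of record, uniformly in `k`, the volume and the background. [cite: BalabanImbrieJaffe1985, (7.3.2) p.326] -/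
theorem decay_kernel_phys {k : ℕ} (hk : j + k ≤ P.m + P.K) {a : ℝ} (ha : 0 < a) (U : GaugeField P j U1) {θ : ℝ}
    (hθ : ∀ (x : Balaban1983to89.Site P j) (μ ν : Fin P.d), ‖plaqC U x μ ν - 1‖ ≤ θ)
    (hsmall : 2 * (P.d : ℝ) ^ 3 * (((P.L : ℝ) ^ k) ^ 2 * θ) ^ 2 ≤ 1)
    {G : FineSp P j →ₗ[ℝ] FineSp P j} (hG : ∀ φ, opT (Dlin (cPhys P k) U) (QlinK U k) a (G φ) = φ)
    (x y : Balaban1983to89.Site P j) :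
    ‖G (PiLp.single 2 y (1 : ℂ)) x‖ ≤ 2 * (P.L : ℝ) ^ (k * P.d) / min (a / 2) (1 / 4)
      * Real.exp (-(Real.sqrt (min (a / 2) (1 / 4) / (12 * P.d + 3 * a)) * (supDist x y : ℝ) / (P.L : ℝ) ^ k)) := by
  have hm'0 : 0 < min (a / 2) (1 / 4) := lt_min (by linarith) (by norm_num)
  have hL : 0 < (P.L : ℝ) ^ (k * P.d) := pow_pos P.cast_L_pos _
  refine kernel_of_pairing (by positivity) x y fun h h' hh hh' => ?_
  refine decay_pairing_phys hk ha U hθ hsmall hG {y} hh (D := supDist x y) fun w hw => ?_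
  rw [hh' w hw, distTo_singleton]

/-- **p. 326 — THE KERNEL OF THE PROPAGATOR OF THE ACTUAL BACKGROUND UNDER (7.3.1), POINTWISE**: for every closed-field index
`i : ClosedIdx d K_R 𝓅` satisfying the printed (7.3.1), in the small-coupling regime `2d³((π/2)K_R·e_k𝓅(e_k))² ≤ 1`, THE propagator
`G_k(u_k)` of (4.6.2) (gen-7's `closedG`) has `|(G_k(u_k)δ_y)(x)| ≤ (2N/min(a_k/2, 1/4))·exp(−t₀(d, a_k)·|x − y|_∞/L^k)` for all η-sites
`x, y` — *"exponential decay"* of the kernel, uniformly in `k`, the volume and `v`. [cite: BalabanImbrieJaffe1985, (7.3.1)–(7.3.2) p.326] -/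
theorem decay_kernel_closedG {d : ℕ} {KR pexp : ℝ} (a : ℝ) (ha : 0 < a) (i : ClosedIdx d KR pexp)
    (h731 : (closedStabData a ha i).Hyp731 pexp)
    (hsmallK : 2 * (d : ℝ) ^ 3 * (Real.pi / 2 * KR * (i.e * (1 + Real.log i.e⁻¹) ^ pexp)) ^ 2 ≤ 1)
    (x y : Balaban1983to89.Site i.P 0) :
    ‖closedG a ha i (PiLp.single 2 y (1 : ℂ)) x‖ ≤
      2 * (i.P.L : ℝ) ^ (i.k * i.P.d) / min (BIJ85Sect4Statements.aK a i.P.L i.k / 2) (1 / 4)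
        * Real.exp (-(Real.sqrt (min (BIJ85Sect4Statements.aK a i.P.L i.k / 2) (1 / 4)
            / (12 * i.P.d + 3 * BIJ85Sect4Statements.aK a i.P.L i.k)) * (supDist x y : ℝ) / (i.P.L : ℝ) ^ i.k)) := by
  have haK := i.aK_pos ha
  have hm'0 : 0 < min (BIJ85Sect4Statements.aK a i.P.L i.k / 2) (1 / 4) := lt_min (by linarith) (by norm_num)
  have hL : 0 < (i.P.L : ℝ) ^ (i.k * i.P.d) := pow_pos i.P.cast_L_pos _
  refine kernel_of_pairing (by positivity) x y fun h h' hh hh' => ?_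
  refine decay_pairing_closedG a ha i h731 hsmallK {y} hh (D := supDist x y) fun w hw => ?_
  rw [hh' w hw, distTo_singleton]

/-! ## §11 The weighted energy: exponential decay of the covariant gradient `D_u(Gh)` away from `supp h` -/

/-- **WEIGHTED ENERGY BOUND, ABSTRACT WEIGHT** (the `H¹` form of the Agmon estimate): with `ω`, `S₁`, `S₂` and
`κ = 2dc²S₁ + a·S₂/(2N) < m₀` as in `BIJ85ScalarPropagatorDecay.agmon_weighted`, for every source `h` and any right inverse `G`,
`‖D_u(ωGh)‖² + a‖Q_k(u)(ωGh)‖² ≤ (m₀/(m₀ − κ)²)·‖ωh‖²` — the same five lines (coercivity at `ωGh`, the two conjugation defects of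
`BIJ85AgmonDefect`, the equation tested against `ω²Gh`, Cauchy–Schwarz) read for the energy instead of the mass term.
[cite: BalabanImbrieJaffe1985, (7.3.2) p.326] -/
theorem agmon_weighted_energy {k : ℕ} (hk : j + k ≤ P.m + P.K) (c : ℝ) {a : ℝ} (ha : 0 < a) (U : GaugeField P j U1) {θ : ℝ}
    (hθ : ∀ (x : Balaban1983to89.Site P j) (μ ν : Fin P.d), ‖plaqC U x μ ν - 1‖ ≤ θ)
    (hsmall : 2 * (P.d : ℝ) ^ 3 * (((P.L : ℝ) ^ k) ^ 2 * θ) ^ 2 ≤ 1)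
    {ω : Balaban1983to89.Site P j → ℝ} {S₁ S₂ : ℝ} (hS₁ : 0 ≤ S₁) (hS₂ : 0 ≤ S₂)
    (hω₁ : ∀ b : PBond P j, (ω b.tgt - ω b.src) ^ 2 ≤ S₁ * (ω b.tgt * ω b.src))
    (hω₂ : ∀ x x' : Balaban1983to89.Site P j, blkIter k x = blkIter k x' → (ω x - ω x') ^ 2 ≤ S₂ * (ω x * ω x'))
    (hκ : 2 * P.d * c ^ 2 * S₁ + a * (S₂ / 2 * ((P.L : ℝ) ^ (k * P.d))⁻¹)
      < min (a / 2) (c ^ 2 * (P.L : ℝ) ^ (k * P.d) / (4 * ((P.L : ℝ) ^ k) ^ 2)) / (P.L : ℝ) ^ (k * P.d))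
    {G : FineSp P j →ₗ[ℝ] FineSp P j} (hG : ∀ φ, opT (Dlin c U) (QlinK U k) a (G φ) = φ) (h : FineSp P j) :
    ‖Dlin c U (wmul ω (G h))‖ ^ 2 + a * ‖QlinK U k (wmul ω (G h))‖ ^ 2 ≤
      (min (a / 2) (c ^ 2 * (P.L : ℝ) ^ (k * P.d) / (4 * ((P.L : ℝ) ^ k) ^ 2)) / (P.L : ℝ) ^ (k * P.d)) /
        (min (a / 2) (c ^ 2 * (P.L : ℝ) ^ (k * P.d) / (4 * ((P.L : ℝ) ^ k) ^ 2)) / (P.L : ℝ) ^ (k * P.d)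
          - (2 * P.d * c ^ 2 * S₁ + a * (S₂ / 2 * ((P.L : ℝ) ^ (k * P.d))⁻¹))) ^ 2 * ‖wmul ω h‖ ^ 2 := by
  have hA := agmon_weighted hk c ha U hθ hsmall hS₁ hS₂ hω₁ hω₂ hκ hG h
  set m₀ := min (a / 2) (c ^ 2 * (P.L : ℝ) ^ (k * P.d) / (4 * ((P.L : ℝ) ^ k) ^ 2)) / (P.L : ℝ) ^ (k * P.d) with hm₀
  set κ := 2 * P.d * c ^ 2 * S₁ + a * (S₂ / 2 * ((P.L : ℝ) ^ (k * P.d))⁻¹) with hκdef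
  set φ := G h with hφ
  have hpos : 0 < m₀ - κ := sub_pos.2 hκ
  have hN : (0 : ℝ) < (P.L : ℝ) ^ (k * P.d) := pow_pos P.cast_L_pos _
  have hκ0 : 0 ≤ κ := by rw [hκdef]; positivity
  -- the two conjugation defects and the weak equation tested against ω²φ
  have h2 := defect_D_le c U hS₁ hω₁ φ
  have h3 := mul_le_mul_of_nonneg_left (defect_Q_le hk U hS₂ hω₂ φ) ha.le
  have h4 : ⟪Dlin c U φ, Dlin c U (wmul ω (wmul ω φ))⟫ + a * ⟪QlinK U k φ, QlinK U k (wmul ω (wmul ω φ))⟫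
      ≤ ‖wmul ω h‖ * ‖wmul ω φ‖ := by
    rw [← inner_opT_left, hφ, hG, ← inner_wmul_comm]
    exact real_inner_le_norm _ _
  have h5 : ‖Dlin c U (wmul ω φ)‖ ^ 2 + a * ‖QlinK U k (wmul ω φ)‖ ^ 2 ≤ ‖wmul ω h‖ * ‖wmul ω φ‖ + κ * ‖wmul ω φ‖ ^ 2 := by
    rw [hκdef]; nlinarith [h2, h3, h4]
  have hwh := norm_nonneg (wmul ω h)
  have hwφ := norm_nonneg (wmul ω φ)
  calc ‖Dlin c U (wmul ω φ)‖ ^ 2 + a * ‖QlinK U k (wmul ω φ)‖ ^ 2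
      ≤ ‖wmul ω h‖ * ‖wmul ω φ‖ + κ * ‖wmul ω φ‖ ^ 2 := h5
    _ ≤ ‖wmul ω h‖ * (‖wmul ω h‖ / (m₀ - κ)) + κ * (‖wmul ω h‖ / (m₀ - κ)) ^ 2 := by gcongr
    _ = m₀ / (m₀ - κ) ^ 2 * ‖wmul ω h‖ ^ 2 := by field_simp; ring

/-- kernel: the distance weight `ρ = t·dist_∞(·, X)/L^k` (`t ≥ 0`) changes by at most `t/L^k` across an η-bond and by at most `t` inside a
`k`-block (`BIJ85ScalarPropagatorDecay.abs_distTo_sub_le`, `supDist_src_tgt_le`, `supDist_le_of_blkIter_eq`). [cite: BalabanImbrieJaffe1985, (7.3.2) p.326] -/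
private theorem rho_dist_lipschitz {k : ℕ} (hk : j + k ≤ P.m + P.K) (X : Finset (Balaban1983to89.Site P j)) {t : ℝ} (ht : 0 ≤ t) :
    (∀ b : PBond P j, |t * (distTo X b.tgt : ℝ) / (P.L : ℝ) ^ k - t * (distTo X b.src : ℝ) / (P.L : ℝ) ^ k| ≤ t / (P.L : ℝ) ^ k) ∧
    (∀ x x' : Balaban1983to89.Site P j, blkIter k x = blkIter k x' →
      |t * (distTo X x : ℝ) / (P.L : ℝ) ^ k - t * (distTo X x' : ℝ) / (P.L : ℝ) ^ k| ≤ t) := by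
  have hn : (0 : ℝ) < (P.L : ℝ) ^ k := pow_pos P.cast_L_pos _
  refine ⟨fun b => ?_, fun x x' hxx' => ?_⟩
  · have h1 := abs_distTo_sub_le (X := X) b.tgt b.src
    have h2 : (supDist b.tgt b.src : ℝ) ≤ 1 := by rw [supDist_comm]; exact_mod_cast supDist_src_tgt_le b
    have e : t * (distTo X b.tgt : ℝ) / (P.L : ℝ) ^ k - t * (distTo X b.src : ℝ) / (P.L : ℝ) ^ k
        = t / (P.L : ℝ) ^ k * ((distTo X b.tgt : ℝ) - distTo X b.src) := by ring
    rw [e, abs_mul, abs_of_nonneg (div_nonneg ht hn.le)]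
    calc t / (P.L : ℝ) ^ k * |(distTo X b.tgt : ℝ) - distTo X b.src| ≤ t / (P.L : ℝ) ^ k * 1 :=
          mul_le_mul_of_nonneg_left (h1.trans h2) (div_nonneg ht hn.le)
      _ = _ := mul_one _
  · have h1 := abs_distTo_sub_le (X := X) x x'
    have h2 : (supDist x x' : ℝ) ≤ (P.L : ℝ) ^ k := by
      have h3 := supDist_le_of_blkIter_eq hk hxx'
      have h4 : ((P.L ^ k - 1 : ℕ) : ℝ) ≤ (P.L : ℝ) ^ k := by
        rw [Nat.cast_sub (Nat.one_le_pow _ _ P.L_pos), Nat.cast_pow, Nat.cast_one]; linarith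
      exact (Nat.cast_le.2 h3).trans h4
    have e : t * (distTo X x : ℝ) / (P.L : ℝ) ^ k - t * (distTo X x' : ℝ) / (P.L : ℝ) ^ k
        = t / (P.L : ℝ) ^ k * ((distTo X x : ℝ) - distTo X x') := by ring
    rw [e, abs_mul, abs_of_nonneg (div_nonneg ht hn.le)]
    calc t / (P.L : ℝ) ^ k * |(distTo X x : ℝ) - distTo X x'| ≤ t / (P.L : ℝ) ^ k * (P.L : ℝ) ^ k :=
          mul_le_mul_of_nonneg_left (h1.trans h2) (div_nonneg ht hn.le)
      _ = t := div_mul_cancel₀ _ hn.ne'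

/-- **EXPONENTIAL DECAY OF THE COVARIANT GRADIENT OF `Gh` AWAY FROM THE SOURCE, PHYSICAL NORMALIZATION** (`c = cPhys`): for EVERY
`U(1)` background with `2d³(L^{2k}·max‖u(∂p) − 1‖)² ≤ 1`, every `a > 0`, any right inverse `G` of `D_u^*D_u + aQ_k(u)^*Q_k(u)` and every
source `h` supported in `X`, the exponentially weighted energy of `Gh` is bounded by the bare `ℓ²` norm of the source:
`‖D_u(e^{ρ}Gh)‖² + a‖Q_k(u)(e^{ρ}Gh)‖² ≤ (4N/min(a/2, 1/4))·‖h‖²`, `ρ = t₀·dist_∞(·, X)/L^k`, `t₀ = √(min(a/2,1/4)/(12d + 3a))` — the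
covariant η-lattice gradient (times `c = η^{(d−2)/2}`) and the block averages of `Gh` decay like `e^{−t₀·dist_∞(·, supp h)/L^k}` in the
`ℓ²` sense, uniformly in `k`, the volume and the background: the `∇G_k` member of the *"decay estimates of [7]"* in energy form.
[cite: BalabanImbrieJaffe1985, (7.3.2) p.326] -/
theorem decay_energy_phys {k : ℕ} (hk : j + k ≤ P.m + P.K) {a : ℝ} (ha : 0 < a) (U : GaugeField P j U1) {θ : ℝ}
    (hθ : ∀ (x : Balaban1983to89.Site P j) (μ ν : Fin P.d), ‖plaqC U x μ ν - 1‖ ≤ θ)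
    (hsmall : 2 * (P.d : ℝ) ^ 3 * (((P.L : ℝ) ^ k) ^ 2 * θ) ^ 2 ≤ 1)
    {G : FineSp P j →ₗ[ℝ] FineSp P j} (hG : ∀ φ, opT (Dlin (cPhys P k) U) (QlinK U k) a (G φ) = φ)
    (X : Finset (Balaban1983to89.Site P j)) {h : FineSp P j} (hh : ∀ x, h x ≠ 0 → x ∈ X) :
    ‖Dlin (cPhys P k) U (wmul (fun x => Real.exp (Real.sqrt (min (a / 2) (1 / 4) / (12 * P.d + 3 * a))
        * (distTo X x : ℝ) / (P.L : ℝ) ^ k)) (G h))‖ ^ 2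
      + a * ‖QlinK U k (wmul (fun x => Real.exp (Real.sqrt (min (a / 2) (1 / 4) / (12 * P.d + 3 * a))
        * (distTo X x : ℝ) / (P.L : ℝ) ^ k)) (G h))‖ ^ 2
      ≤ 4 * (P.L : ℝ) ^ (k * P.d) / min (a / 2) (1 / 4) * ‖h‖ ^ 2 := by
  obtain ⟨hmin, hκ⟩ := phys_constants (P := P) k ha
  obtain ⟨hρ₁, hρ₂⟩ := rho_dist_lipschitz hk X (Real.sqrt_nonneg (min (a / 2) (1 / 4) / (12 * P.d + 3 * a)))
  have hC := norm_wmul_exp_eq (ρ := fun x => Real.sqrt (min (a / 2) (1 / 4) / (12 * P.d + 3 * a)) * (distTo X x : ℝ) / (P.L : ℝ) ^ k)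
    (h := h) (fun x hx => by simp [distTo_eq_zero_of_mem (hh x hx)])
  set m' := min (a / 2) (1 / 4) with hm'
  set t₀ := Real.sqrt (m' / (12 * P.d + 3 * a)) with ht₀
  set n : ℝ := (P.L : ℝ) ^ k with hn
  set N : ℝ := (P.L : ℝ) ^ (k * P.d) with hN
  have hN0 : 0 < N := pow_pos P.cast_L_pos _
  have hm'0 : 0 < m' := lt_min (by linarith) (by norm_num)
  have hω₁ := fun b : PBond P j => sq_exp_sub_exp_le_of_abs_le (hρ₁ b)
  have hω₂ := fun (x x' : Balaban1983to89.Site P j) (hxx' : blkIter k x = blkIter k x') => sq_exp_sub_exp_le_of_abs_le (hρ₂ x x' hxx')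
  have hlt : 2 * P.d * cPhys P k ^ 2 * ((t₀ / n) ^ 2 * Real.exp (t₀ / n)) + a * (t₀ ^ 2 * Real.exp t₀ / 2 * N⁻¹)
      < min (a / 2) (cPhys P k ^ 2 * N / (4 * n ^ 2)) / N := by
    rw [hmin]
    refine hκ.trans_lt ?_
    rw [div_lt_div_iff₀ (by positivity) hN0]
    nlinarith
  have hE := agmon_weighted_energy hk (cPhys P k) ha U hθ hsmall (by positivity) (by positivity) hω₁ hω₂ hlt hG h
  rw [hmin, hC] at hE
  refine hE.trans ?_
  have hden : (m' / (2 * N)) ^ 2 ≤ (m' / N - (2 * P.d * cPhys P k ^ 2 * ((t₀ / n) ^ 2 * Real.exp (t₀ / n))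
      + a * (t₀ ^ 2 * Real.exp t₀ / 2 * N⁻¹))) ^ 2 := by
    have h1 : m' / (2 * N) ≤ m' / N - (2 * P.d * cPhys P k ^ 2 * ((t₀ / n) ^ 2 * Real.exp (t₀ / n))
        + a * (t₀ ^ 2 * Real.exp t₀ / 2 * N⁻¹)) := by
      have : m' / N - m' / (2 * N) = m' / (2 * N) := by field_simp; ring
      linarith
    exact pow_le_pow_left₀ (by positivity) h1 2
  calc m' / N / (m' / N - (2 * P.d * cPhys P k ^ 2 * ((t₀ / n) ^ 2 * Real.exp (t₀ / n))
          + a * (t₀ ^ 2 * Real.exp t₀ / 2 * N⁻¹))) ^ 2 * ‖h‖ ^ 2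
      ≤ m' / N / (m' / (2 * N)) ^ 2 * ‖h‖ ^ 2 :=
        mul_le_mul_of_nonneg_right (div_le_div_of_nonneg_left (by positivity) (by positivity) hden) (sq_nonneg _)
    _ = 4 * N / m' * ‖h‖ ^ 2 := by field_simp; ring

/-- **p. 326 — THE COVARIANT GRADIENT OF THE PROPAGATOR OF THE ACTUAL BACKGROUND UNDER (7.3.1), WEIGHTED ENERGY FORM**: for every
closed-field index `i : ClosedIdx d K_R 𝓅` satisfying the printed (7.3.1), in the small-coupling regime `2d³((π/2)K_R·e_k𝓅(e_k))² ≤ 1`,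
THE propagator `G_k(u_k)` of (4.6.2) (gen-7's `closedG`, mass `a_k`) satisfies, for every source `h` supported in `X`,
`‖D_{u_k}(e^{ρ}G_k(u_k)h)‖² + a_k‖Q_k(u_k)(e^{ρ}G_k(u_k)h)‖² ≤ (4N/min(a_k/2, 1/4))·‖h‖²`, `ρ = t₀(d, a_k)·dist_∞(·, X)/L^k` — uniformly
in `k`, the volume and `v`. [cite: BalabanImbrieJaffe1985, (7.3.1)–(7.3.2) p.326] -/
theorem decay_energy_closedG {d : ℕ} {KR pexp : ℝ} (a : ℝ) (ha : 0 < a) (i : ClosedIdx d KR pexp)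
    (h731 : (closedStabData a ha i).Hyp731 pexp)
    (hsmallK : 2 * (d : ℝ) ^ 3 * (Real.pi / 2 * KR * (i.e * (1 + Real.log i.e⁻¹) ^ pexp)) ^ 2 ≤ 1)
    (X : Finset (Balaban1983to89.Site i.P 0)) {h : FineSp i.P 0} (hh : ∀ x, h x ≠ 0 → x ∈ X) :
    ‖Dlin (cPhys i.P i.k) i.U (wmul (fun x => Real.exp (Real.sqrt (min (BIJ85Sect4Statements.aK a i.P.L i.k / 2) (1 / 4)
        / (12 * i.P.d + 3 * BIJ85Sect4Statements.aK a i.P.L i.k)) * (distTo X x : ℝ) / (i.P.L : ℝ) ^ i.k)) (closedG a ha i h))‖ ^ 2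
      + BIJ85Sect4Statements.aK a i.P.L i.k * ‖QlinK i.U i.k (wmul (fun x => Real.exp (Real.sqrt
        (min (BIJ85Sect4Statements.aK a i.P.L i.k / 2) (1 / 4) / (12 * i.P.d + 3 * BIJ85Sect4Statements.aK a i.P.L i.k))
        * (distTo X x : ℝ) / (i.P.L : ℝ) ^ i.k)) (closedG a ha i h))‖ ^ 2
      ≤ 4 * (i.P.L : ℝ) ^ (i.k * i.P.d) / min (BIJ85Sect4Statements.aK a i.P.L i.k / 2) (1 / 4) * ‖h‖ ^ 2 := by
  have hθ := theta_of_hyp731_closed a ha i h731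
  have hsmall : 2 * (i.P.d : ℝ) ^ 3 *
      (((i.P.L : ℝ) ^ i.k) ^ 2 * (i.e * (i.P.eta i.k) ^ 2 * (KR * (Real.pi / 2 * (1 + Real.log i.e⁻¹) ^ pexp)))) ^ 2 ≤ 1 := by
    have e : ((i.P.L : ℝ) ^ i.k) ^ 2 * (i.e * (i.P.eta i.k) ^ 2 * (KR * (Real.pi / 2 * (1 + Real.log i.e⁻¹) ^ pexp)))
        = Real.pi / 2 * KR * (i.e * (1 + Real.log i.e⁻¹) ^ pexp) := by
      have h1 := pow_mul_eta_sq i.P i.k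
      calc ((i.P.L : ℝ) ^ i.k) ^ 2 * (i.e * (i.P.eta i.k) ^ 2 * (KR * (Real.pi / 2 * (1 + Real.log i.e⁻¹) ^ pexp)))
          = (((i.P.L : ℝ) ^ i.k) ^ 2 * (i.P.eta i.k) ^ 2) * (Real.pi / 2 * KR * (i.e * (1 + Real.log i.e⁻¹) ^ pexp)) := by ring
        _ = _ := by rw [h1, one_mul]
    rw [e, i.hd]; exact hsmallK
  exact decay_energy_phys i.hk0 (i.aK_pos ha) i.U hθ hsmall (closedG_spec a ha i) X hh

/-! ## §12 The covariant gradient of the kernel, pointwise -/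

/-- kernel (product rule for the weighted covariant difference of (4.6.3)): `D_u(ωφ)(b) − ω(b₋)·(D_uφ)(b) = c(ω(b₊) − ω(b₋))·u_bφ(b₊)`.
[cite: BalabanImbrieJaffe1985, (4.6.3) p.313] -/
private theorem covD_wmul_sub (c : ℝ) (U : GaugeField P j U1) (ω : Balaban1983to89.Site P j → ℝ) (φ : FineSp P j) (b : PBond P j) :
    Dlin c U (wmul ω φ) b - (ω b.src : ℂ) * Dlin c U φ b = (c : ℂ) * ((ω b.tgt - ω b.src : ℝ) : ℂ) * (toC (U b) * φ b.tgt) := by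
  rw [Dlin_apply, Dlin_apply]
  show (c : ℂ) * (toC (U b) * ((ω b.tgt : ℂ) * φ b.tgt) - (ω b.src : ℂ) * φ b.src)
      - (ω b.src : ℂ) * ((c : ℂ) * (toC (U b) * φ b.tgt - φ b.src)) = _
  push_cast
  ring

/-- kernel (real analysis): `|x − y| ≤ δ` ⇒ `|e^x − e^y| ≤ δe^δ·e^x`. [cite: BalabanImbrieJaffe1985, (7.3.2) p.326] -/
private theorem abs_exp_sub_exp_le {x y δ : ℝ} (h : |x - y| ≤ δ) :
    |Real.exp x - Real.exp y| ≤ δ * Real.exp δ * Real.exp x := by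
  have hδ : 0 ≤ δ := (abs_nonneg _).trans h
  have h1 := sq_exp_sub_exp_le_of_abs_le h
  have h2 : Real.exp y ≤ Real.exp x * Real.exp δ := by
    rw [← Real.exp_add]; exact Real.exp_le_exp.2 (by linarith [(abs_le.1 h).1])
  have h1δ : 1 ≤ Real.exp δ := Real.one_le_exp hδ
  have h3 : (Real.exp x - Real.exp y) ^ 2 ≤ (δ * Real.exp δ * Real.exp x) ^ 2 := by
    calc (Real.exp x - Real.exp y) ^ 2 ≤ δ ^ 2 * Real.exp δ * (Real.exp x * Real.exp y) := h1
      _ ≤ δ ^ 2 * Real.exp δ * (Real.exp x * (Real.exp x * Real.exp δ)) := by gcongr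
      _ ≤ (δ * Real.exp δ * Real.exp x) ^ 2 := by
          have hx := Real.exp_pos x
          nlinarith [mul_nonneg (mul_nonneg (sq_nonneg δ) (Real.exp_pos δ).le) (mul_pos hx hx).le]
  exact abs_le_of_sq_le_sq h3 (by positivity)

/-- **POINTWISE EXPONENTIAL DECAY OF THE COVARIANT GRADIENT OF THE KERNEL**, physical normalization: for EVERY `U(1)` background with
`2d³(L^{2k}·max‖u(∂p) − 1‖)² ≤ 1`, every `a > 0`, any right inverse `G` of `D_u^*D_u + aQ_k(u)^*Q_k(u)`, every η-bond `b` and every site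
`y`: `|u_b·G(b₊, y) − G(b₋, y)| ≤ (2N/n)(1/√m′ + 3t₀/m′)·exp(−t₀·|b₋ − y|_∞/L^k)` (`G(x, y) = (Gδ_y)(x)`, `n = L^k`, `N = L^{kd}`,
`m′ = min(a/2, 1/4)`, `t₀ = √(m′/(12d + 3a))`), i.e. the η-lattice covariant gradient `η⁻¹(u_bG(b₊, y) − G(b₋, y))` of the kernel
(base level `0`: `η⁻¹ = n`) is at most `2N(1/√m′ + 3t₀/m′)e^{−t₀·dist/L^k}` — the `m = 1` (first covariant derivative) member of the
printed *"|∇G_k(x, y)| ≤ O(1)…e^{−δ|x−y|}"* ([6I] (1.110), [7] Thm 1.1) for the torus operator of record, exponential DECAY part with a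
crude diagonal constant: one coordinate of the weighted energy `decay_energy_phys` at `h = δ_y`, the product rule `covD_wmul_sub`, and the
kernel bound `decay_kernel_phys` for the commutator term. [cite: BalabanImbrieJaffe1985, (7.3.2) p.326] -/
theorem decay_gradKernel_phys {k : ℕ} (hk : j + k ≤ P.m + P.K) {a : ℝ} (ha : 0 < a) (U : GaugeField P j U1) {θ : ℝ}
    (hθ : ∀ (x : Balaban1983to89.Site P j) (μ ν : Fin P.d), ‖plaqC U x μ ν - 1‖ ≤ θ)
    (hsmall : 2 * (P.d : ℝ) ^ 3 * (((P.L : ℝ) ^ k) ^ 2 * θ) ^ 2 ≤ 1)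
    {G : FineSp P j →ₗ[ℝ] FineSp P j} (hG : ∀ φ, opT (Dlin (cPhys P k) U) (QlinK U k) a (G φ) = φ)
    (b : PBond P j) (y : Balaban1983to89.Site P j) :
    ‖toC (U b) * G (PiLp.single 2 y (1 : ℂ)) b.tgt - G (PiLp.single 2 y (1 : ℂ)) b.src‖ ≤
      2 * (P.L : ℝ) ^ (k * P.d) / (P.L : ℝ) ^ k
        * (1 / Real.sqrt (min (a / 2) (1 / 4)) + 3 * Real.sqrt (min (a / 2) (1 / 4) / (12 * P.d + 3 * a)) / min (a / 2) (1 / 4))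
        * Real.exp (-(Real.sqrt (min (a / 2) (1 / 4) / (12 * P.d + 3 * a)) * (supDist b.src y : ℝ) / (P.L : ℝ) ^ k)) := by
  -- the three inputs, instantiated before abbreviating
  have hsupp : ∀ w, (PiLp.single 2 y (1 : ℂ) : FineSp P j) w ≠ 0 → w ∈ ({y} : Finset (Balaban1983to89.Site P j)) := by
    intro w hw
    rw [PiLp.single_apply] at hw
    by_cases hwy : w = y
    · rw [hwy]; exact Finset.mem_singleton_self y
    · exact (hw (if_neg hwy)).elim
  have hE := decay_energy_phys hk ha U hθ hsmall hG {y} hsupp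
  have hK := decay_kernel_phys hk ha U hθ hsmall hG b.tgt y
  obtain ⟨hρ₁, -⟩ := rho_dist_lipschitz hk ({y} : Finset (Balaban1983to89.Site P j))
    (Real.sqrt_nonneg (min (a / 2) (1 / 4) / (12 * P.d + 3 * a)))
  have hρb := hρ₁ b
  have hcval : cPhys P k = (P.L : ℝ) ^ k / Real.sqrt ((P.L : ℝ) ^ (k * P.d)) := by
    unfold cPhys
    rw [Real.sqrt_div (sq_nonneg _), Real.sqrt_sq (pow_pos P.cast_L_pos _).le]
  -- abbreviations
  set m' := min (a / 2) (1 / 4) with hm'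
  set t₀ := Real.sqrt (m' / (12 * P.d + 3 * a)) with ht₀
  set n : ℝ := (P.L : ℝ) ^ k with hn
  set N : ℝ := (P.L : ℝ) ^ (k * P.d) with hN
  set W : Balaban1983to89.Site P j → ℝ := fun x => Real.exp (t₀ * (distTo {y} x : ℝ) / n) with hW
  set δy : FineSp P j := PiLp.single 2 y (1 : ℂ) with hδy
  set φ := G δy with hφ
  have hn0 : 0 < n := pow_pos P.cast_L_pos _
  have hn1 : 1 ≤ n := one_le_pow₀ (by exact_mod_cast P.L_pos)
  have hN0 : 0 < N := pow_pos P.cast_L_pos _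
  have hd1 : (1 : ℝ) ≤ P.d := by exact_mod_cast P.hd
  have hm'0 : 0 < m' := lt_min (by linarith) (by norm_num)
  have hm'1 : m' ≤ 1 / 4 := min_le_right _ _
  have ht₀0 : 0 ≤ t₀ := Real.sqrt_nonneg _
  have ht₀1 : t₀ ≤ 1 := by
    rw [ht₀]
    refine Real.sqrt_le_one.mpr ?_
    rw [div_le_one (by linarith)]; linarith
  have hc0 : 0 < cPhys P k := cPhys_pos P k
  have hWt : 0 < W b.tgt := Real.exp_pos _
  have hWs : 0 < W b.src := Real.exp_pos _
  have hnormδ : ‖δy‖ = 1 := by rw [hδy, PiLp.norm_single, norm_one]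
  -- (1) one coordinate of the weighted energy: ‖D_u(Wφ)(b)‖² ≤ 4N/m′
  have h1 : ‖Dlin (cPhys P k) U (wmul W φ) b‖ ^ 2 ≤ 4 * N / m' := by
    have hQ : 0 ≤ a * ‖QlinK U k (wmul W φ)‖ ^ 2 := by positivity
    have hco := pow_le_pow_left₀ (norm_nonneg _) (PiLp.norm_apply_le (Dlin (cPhys P k) U (wmul W φ)) b) 2
    rw [hnormδ, one_pow, mul_one] at hE
    linarith
  -- (2) the product rule, in norm: c·W(b₋)·‖u_bφ(b₊) − φ(b₋)‖ ≤ ‖D_u(Wφ)(b)‖ + c·|W(b₊) − W(b₋)|·‖φ(b₊)‖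
  have h3 := covD_wmul_sub (cPhys P k) U W φ b
  have hDφ : Dlin (cPhys P k) U φ b = (cPhys P k : ℂ) * (toC (U b) * φ b.tgt - φ b.src) := rfl
  have h4 : cPhys P k * W b.src * ‖toC (U b) * φ b.tgt - φ b.src‖
      ≤ ‖Dlin (cPhys P k) U (wmul W φ) b‖ + cPhys P k * |W b.tgt - W b.src| * ‖φ b.tgt‖ := by
    have e : ((cPhys P k : ℂ) * (W b.src : ℂ)) * (toC (U b) * φ b.tgt - φ b.src)
        = Dlin (cPhys P k) U (wmul W φ) b - (cPhys P k : ℂ) * ((W b.tgt - W b.src : ℝ) : ℂ) * (toC (U b) * φ b.tgt) := by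
      rw [← h3, hDφ]; ring
    calc cPhys P k * W b.src * ‖toC (U b) * φ b.tgt - φ b.src‖
        = ‖((cPhys P k : ℂ) * (W b.src : ℂ)) * (toC (U b) * φ b.tgt - φ b.src)‖ := by
          rw [norm_mul, norm_mul, Complex.norm_real, Complex.norm_real, Real.norm_of_nonneg hc0.le,
            Real.norm_of_nonneg hWs.le]
      _ = ‖Dlin (cPhys P k) U (wmul W φ) b - (cPhys P k : ℂ) * ((W b.tgt - W b.src : ℝ) : ℂ) * (toC (U b) * φ b.tgt)‖ := by
          rw [e]
      _ ≤ ‖Dlin (cPhys P k) U (wmul W φ) b‖ + ‖(cPhys P k : ℂ) * ((W b.tgt - W b.src : ℝ) : ℂ) * (toC (U b) * φ b.tgt)‖ :=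
          norm_sub_le _ _
      _ = ‖Dlin (cPhys P k) U (wmul W φ) b‖ + cPhys P k * |W b.tgt - W b.src| * ‖φ b.tgt‖ := by
          rw [norm_mul, norm_mul, norm_mul, Complex.norm_real, Complex.norm_real, Real.norm_of_nonneg hc0.le,
            Real.norm_eq_abs, norm_toC, one_mul]
  -- (3) the three factors: ‖D(Wφ)(b)‖ ≤ 2√(N/m′); |W₊ − W₋| ≤ (t₀/n)e^{t₀/n}W₊ ≤ 3(t₀/n)W₊; ‖φ(b₊)‖ ≤ (2N/m′)/W₊
  have h5 : ‖Dlin (cPhys P k) U (wmul W φ) b‖ ≤ 2 * Real.sqrt (N / m') := by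
    have hs : (2 * Real.sqrt (N / m')) ^ 2 = 4 * N / m' := by
      rw [mul_pow, Real.sq_sqrt (div_nonneg hN0.le hm'0.le)]; ring
    exact le_of_sq_le_sq (h1.trans_eq hs.symm) (by positivity)
  have h6 : |W b.tgt - W b.src| ≤ 3 * (t₀ / n) * W b.tgt := by
    have h := abs_exp_sub_exp_le hρb
    have he : Real.exp (t₀ / n) ≤ 3 := by
      have h3' : Real.exp 1 ≤ 3 := by have := Real.exp_one_lt_d9; linarith
      exact (Real.exp_le_exp.2 ((div_le_self ht₀0 hn1).trans ht₀1)).trans h3'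
    calc |W b.tgt - W b.src| ≤ t₀ / n * Real.exp (t₀ / n) * W b.tgt := h
      _ ≤ t₀ / n * 3 * W b.tgt := by gcongr
      _ = 3 * (t₀ / n) * W b.tgt := by ring
  have h7 : ‖φ b.tgt‖ * W b.tgt ≤ 2 * N / m' := by
    have hdist : (distTo {y} b.tgt : ℝ) = supDist b.tgt y := by rw [distTo_singleton]
    have eW : W b.tgt = Real.exp (t₀ * (supDist b.tgt y : ℝ) / n) := by simp only [hW, hdist]
    have hK' : ‖φ b.tgt‖ ≤ 2 * N / m' * Real.exp (-(t₀ * (supDist b.tgt y : ℝ) / n)) := hK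
    calc ‖φ b.tgt‖ * W b.tgt ≤ 2 * N / m' * Real.exp (-(t₀ * (supDist b.tgt y : ℝ) / n)) * W b.tgt :=
          mul_le_mul_of_nonneg_right hK' hWt.le
      _ = 2 * N / m' := by rw [eW, mul_assoc, ← Real.exp_add, neg_add_cancel, Real.exp_zero, mul_one]
  -- (4) assemble: c·W₋·X ≤ 2√(N/m′) + c·3(t₀/n)·(2N/m′)
  have h8 : cPhys P k * W b.src * ‖toC (U b) * φ b.tgt - φ b.src‖
      ≤ 2 * Real.sqrt (N / m') + cPhys P k * (3 * (t₀ / n)) * (2 * N / m') := by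
    refine h4.trans ?_
    have : cPhys P k * |W b.tgt - W b.src| * ‖φ b.tgt‖ ≤ cPhys P k * (3 * (t₀ / n)) * (2 * N / m') := by
      calc cPhys P k * |W b.tgt - W b.src| * ‖φ b.tgt‖ ≤ cPhys P k * (3 * (t₀ / n) * W b.tgt) * ‖φ b.tgt‖ := by gcongr
        _ = cPhys P k * (3 * (t₀ / n)) * (‖φ b.tgt‖ * W b.tgt) := by ring
        _ ≤ cPhys P k * (3 * (t₀ / n)) * (2 * N / m') := by gcongr
    linarith
  -- (5) divide by c·W₋: c = n/√N, 2√(N/m′)/c = 2N/(n√m′), and 1/W₋ = e^{−t₀|b₋ − y|_∞/n}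
  have hsN0 : 0 < Real.sqrt N := Real.sqrt_pos.2 hN0
  have hsm0 : 0 < Real.sqrt m' := Real.sqrt_pos.2 hm'0
  have hsdiv : Real.sqrt (N / m') = Real.sqrt N / Real.sqrt m' := Real.sqrt_div hN0.le m'
  have hdists : (distTo {y} b.src : ℝ) = supDist b.src y := by rw [distTo_singleton]
  have eWs : (W b.src)⁻¹ = Real.exp (-(t₀ * (supDist b.src y : ℝ) / n)) := by
    simp only [hW, hdists, Real.exp_neg]
  have hkey : ‖toC (U b) * φ b.tgt - φ b.src‖
      ≤ (2 * Real.sqrt (N / m') + cPhys P k * (3 * (t₀ / n)) * (2 * N / m')) / (cPhys P k * W b.src) := by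
    rw [le_div_iff₀ (mul_pos hc0 hWs)]
    calc ‖toC (U b) * φ b.tgt - φ b.src‖ * (cPhys P k * W b.src)
        = cPhys P k * W b.src * ‖toC (U b) * φ b.tgt - φ b.src‖ := by ring
      _ ≤ _ := h8
  have halg : ∀ sN sm t ν : ℝ, 0 < sN → 0 < sm → 0 < ν →
      (2 * (sN / sm) + ν / sN * (3 * (t / ν)) * (2 * sN ^ 2 / sm ^ 2)) / (ν / sN) = 2 * sN ^ 2 / ν * (1 / sm + 3 * t / sm ^ 2) := by
    intro sN sm t ν hsN hsm hν
    field_simp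
  have h9 := halg (Real.sqrt N) (Real.sqrt m') t₀ n hsN0 hsm0 hn0
  rw [Real.sq_sqrt hN0.le, Real.sq_sqrt hm'0.le] at h9
  refine hkey.trans (le_of_eq ?_)
  rw [div_mul_eq_div_div, div_eq_mul_inv _ (W b.src), hsdiv, hcval, h9, eWs]

/-- kernel: for a closed-field index, the printed smallness `2d³((π/2)K_R·e𝓅(e))² ≤ 1` is the block-scale plaquette smallness
`2d³(L^{2k}θ)² ≤ 1` at gen-7's `θ = eη²K_R(π/2)𝓅(e)` (`(L^k)²η² = 1`). [cite: BalabanImbrieJaffe1985, (7.3.1) p.326] -/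
private theorem smallK_closed {d : ℕ} {KR pexp : ℝ} (i : ClosedIdx d KR pexp)
    (hsmallK : 2 * (d : ℝ) ^ 3 * (Real.pi / 2 * KR * (i.e * (1 + Real.log i.e⁻¹) ^ pexp)) ^ 2 ≤ 1) :
    2 * (i.P.d : ℝ) ^ 3 *
      (((i.P.L : ℝ) ^ i.k) ^ 2 * (i.e * (i.P.eta i.k) ^ 2 * (KR * (Real.pi / 2 * (1 + Real.log i.e⁻¹) ^ pexp)))) ^ 2 ≤ 1 := by
  have e : ((i.P.L : ℝ) ^ i.k) ^ 2 * (i.e * (i.P.eta i.k) ^ 2 * (KR * (Real.pi / 2 * (1 + Real.log i.e⁻¹) ^ pexp)))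
      = Real.pi / 2 * KR * (i.e * (1 + Real.log i.e⁻¹) ^ pexp) := by
    have h1 := pow_mul_eta_sq i.P i.k
    calc ((i.P.L : ℝ) ^ i.k) ^ 2 * (i.e * (i.P.eta i.k) ^ 2 * (KR * (Real.pi / 2 * (1 + Real.log i.e⁻¹) ^ pexp)))
        = (((i.P.L : ℝ) ^ i.k) ^ 2 * (i.P.eta i.k) ^ 2) * (Real.pi / 2 * KR * (i.e * (1 + Real.log i.e⁻¹) ^ pexp)) := by ring
      _ = _ := by rw [h1, one_mul]
  rw [e, i.hd]; exact hsmallK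

/-- **p. 326 — THE COVARIANT GRADIENT OF THE KERNEL OF THE PROPAGATOR OF THE ACTUAL BACKGROUND UNDER (7.3.1), POINTWISE**: for every
closed-field index `i : ClosedIdx d K_R 𝓅` satisfying the printed (7.3.1), in the small-coupling regime `2d³((π/2)K_R·e_k𝓅(e_k))² ≤ 1`,
THE propagator `G_k(u_k)` of (4.6.2) (gen-7's `closedG`) has, for every η-bond `b` and every site `y`,
`|u_k(b)·(G_k(u_k)δ_y)(b₊) − (G_k(u_k)δ_y)(b₋)| ≤ (2N/n)(1/√m′ + 3t₀/m′)·e^{−t₀|b₋ − y|_∞/L^k}` (`m′ = min(a_k/2, 1/4)`, `t₀ = t₀(d, a_k)`)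
— exponential decay of the covariant gradient of the kernel, uniformly in `k`, the volume and `v`. [cite: BalabanImbrieJaffe1985, (7.3.1)–(7.3.2) p.326] -/
theorem decay_gradKernel_closedG {d : ℕ} {KR pexp : ℝ} (a : ℝ) (ha : 0 < a) (i : ClosedIdx d KR pexp)
    (h731 : (closedStabData a ha i).Hyp731 pexp)
    (hsmallK : 2 * (d : ℝ) ^ 3 * (Real.pi / 2 * KR * (i.e * (1 + Real.log i.e⁻¹) ^ pexp)) ^ 2 ≤ 1)
    (b : PBond i.P 0) (y : Balaban1983to89.Site i.P 0) :
    ‖toC (i.U b) * closedG a ha i (PiLp.single 2 y (1 : ℂ)) b.tgt - closedG a ha i (PiLp.single 2 y (1 : ℂ)) b.src‖ ≤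
      2 * (i.P.L : ℝ) ^ (i.k * i.P.d) / (i.P.L : ℝ) ^ i.k
        * (1 / Real.sqrt (min (BIJ85Sect4Statements.aK a i.P.L i.k / 2) (1 / 4))
          + 3 * Real.sqrt (min (BIJ85Sect4Statements.aK a i.P.L i.k / 2) (1 / 4)
              / (12 * i.P.d + 3 * BIJ85Sect4Statements.aK a i.P.L i.k)) / min (BIJ85Sect4Statements.aK a i.P.L i.k / 2) (1 / 4))
        * Real.exp (-(Real.sqrt (min (BIJ85Sect4Statements.aK a i.P.L i.k / 2) (1 / 4)
            / (12 * i.P.d + 3 * BIJ85Sect4Statements.aK a i.P.L i.k)) * (supDist b.src y : ℝ) / (i.P.L : ℝ) ^ i.k)) :=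
  decay_gradKernel_phys i.hk0 (i.aK_pos ha) i.U (theta_of_hyp731_closed a ha i h731) (smallK_closed i hsmallK)
    (closedG_spec a ha i) b y

end

end Literature.MathematicalPhysics.QuantumFieldTheory.BalabanImbrieJaffe1984to88.BIJ85Claim73PropagatorDecay
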